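import Mathlib

/-!
# Route `JensenPolynomials`, FAR crux `XiWindowZeroFreeRelFar` (B1-rel far) — contour tools VI: from a relative Laplace
approximation to zero-freeness and the logarithm (RH-FREE; cell rh-jensen, HUMAN RULING D-0040)

Stub S3 `stub_laplaceFar` of theory g8's line «far-gumbel» (item `stmt-RiemannHypothesis-19465`) asserts `J ≠ 0` and a
two-sided bound for `log‖J‖`. After the contour shift and the window/descent estimates one has `‖J − m‖ ≤ θ‖m‖` with the
Laplace main term `m = e^{Ψ(u_s)}·(π/c)^{1/2}` and `θ < 1`. This file is the bookkeeping from there: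

* `ne_zero_of_norm_sub_le_mul` / `abs_log_norm_sub_log_norm_le`: `‖J − m‖ ≤ θ‖m‖`, `θ < 1`, `m ≠ 0` ⇒ `J ≠ 0` and
  `|log‖J‖ − log‖m‖| ≤ −log(1 − θ)` (`≤ 2θ` for `θ ≤ 1/2`);
* `log_norm_cexp_mul_cpow_half`: `log‖e^{Ψ}·(π/c)^{1/2}‖ = Re Ψ + ½(log π − log‖c‖)` for `c ≠ 0` (principal branch).

WHAT THIS IS NOT: elementary inequalities for `log`; nothing here bears on the zeros of `ζ` or the truth of RH.
-/

noncomputable section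
-- D-0017: `Summit.RiemannHypothesis.RiemannHypothesis.…` duplicates the namespace BY DESIGN (single-problem summit).
set_option linter.dupNamespace false

namespace Summit.RiemannHypothesis.RiemannHypothesis.Theorems.JensenPolynomials.WindowEGF

open Complex

/-- If `‖J − m‖ ≤ θ‖m‖` with `θ < 1` and `m ≠ 0`, then `(1 − θ)‖m‖ ≤ ‖J‖ ≤ (1 + θ)‖m‖`. -/
theorem norm_bounds_of_norm_sub_le_mul {J m : ℂ} {θ : ℝ} (h : ‖J - m‖ ≤ θ * ‖m‖) :
    (1 - θ) * ‖m‖ ≤ ‖J‖ ∧ ‖J‖ ≤ (1 + θ) * ‖m‖ := by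
  constructor
  · have h1 : ‖m‖ - ‖J - m‖ ≤ ‖J‖ := by
      have := norm_sub_norm_le m (m - J)
      rw [sub_sub_cancel, norm_sub_rev] at this
      linarith
    linarith
  · have h2 : ‖J‖ ≤ ‖m‖ + ‖J - m‖ := by
      have := norm_add_le m (J - m)
      rwa [add_sub_cancel] at this
    linarith

/-- **Zero-freeness from a relative approximation**: `‖J − m‖ ≤ θ‖m‖`, `θ < 1`, `m ≠ 0` ⇒ `J ≠ 0`. -/
theorem ne_zero_of_norm_sub_le_mul {J m : ℂ} {θ : ℝ} (hθ : θ < 1) (hm : m ≠ 0) (h : ‖J - m‖ ≤ θ * ‖m‖) :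
    J ≠ 0 := by
  intro hJ
  have h1 := (norm_bounds_of_norm_sub_le_mul h).1
  rw [hJ, norm_zero] at h1
  have hmpos : 0 < ‖m‖ := norm_pos_iff.mpr hm
  nlinarith

/-- **The logarithm from a relative approximation**: `‖J − m‖ ≤ θ‖m‖`, `0 ≤ θ < 1`, `m ≠ 0` ⇒
`|log‖J‖ − log‖m‖| ≤ −log(1 − θ)`. -/
theorem abs_log_norm_sub_log_norm_le {J m : ℂ} {θ : ℝ} (hθ0 : 0 ≤ θ) (hθ : θ < 1) (hm : m ≠ 0)
    (h : ‖J - m‖ ≤ θ * ‖m‖) : |Real.log ‖J‖ - Real.log ‖m‖| ≤ -Real.log (1 - θ) := by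
  have hmpos : 0 < ‖m‖ := norm_pos_iff.mpr hm
  obtain ⟨hlo, hhi⟩ := norm_bounds_of_norm_sub_le_mul h
  have h1θ : 0 < 1 - θ := by linarith
  have hJpos : 0 < ‖J‖ := lt_of_lt_of_le (mul_pos h1θ hmpos) hlo
  rw [← Real.log_div hJpos.ne' hmpos.ne', abs_le]
  constructor
  · -- lower: log(‖J‖/‖m‖) ≥ log(1 − θ)
    have hq : 1 - θ ≤ ‖J‖ / ‖m‖ := by rw [le_div_iff₀ hmpos]; exact hlo
    have := Real.log_le_log h1θ hq
    linarith
  · -- upper: log(‖J‖/‖m‖) ≤ log(1 + θ) ≤ −log(1 − θ)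
    have hq : ‖J‖ / ‖m‖ ≤ 1 + θ := by rw [div_le_iff₀ hmpos]; exact hhi
    have hqpos : 0 < ‖J‖ / ‖m‖ := div_pos hJpos hmpos
    have h1 := Real.log_le_log hqpos hq
    -- `log(1+θ) + log(1−θ) = log(1 − θ²) ≤ 0`
    have h2 : Real.log (1 + θ) + Real.log (1 - θ) ≤ 0 := by
      rw [← Real.log_mul (by linarith) h1θ.ne']
      apply Real.log_nonpos (by nlinarith) (by nlinarith)
    linarith

/-- `−log(1 − θ) ≤ 2θ` for `0 ≤ θ ≤ 1/2`. -/
theorem neg_log_one_sub_le_two_mul {θ : ℝ} (hθ0 : 0 ≤ θ) (hθ : θ ≤ 1 / 2) : -Real.log (1 - θ) ≤ 2 * θ := by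
  -- `1 − θ ≥ e^{−2θ}` on `[0, 1/2]` since `e^{−2θ} ≤ 1/(1+2θ) ≤ 1 − θ`… use `add_one_le_exp`: `1 − 2θ ≤ e^{−2θ}` is the
  -- wrong direction; instead `e^{2θ} ≥ 1 + 2θ ≥ 1/(1−θ)` for `θ ≤ 1/2`.
  have h1θ : 0 < 1 - θ := by linarith
  have key : 1 / (1 - θ) ≤ Real.exp (2 * θ) := by
    have h1 : 1 + 2 * θ ≤ Real.exp (2 * θ) := by linarith [Real.add_one_le_exp (2 * θ)]
    have h2 : 1 / (1 - θ) ≤ 1 + 2 * θ := by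
      rw [div_le_iff₀ h1θ]; nlinarith
    linarith
  have := Real.log_le_log (by positivity) key
  rw [Real.log_exp, one_div, Real.log_inv] at this
  linarith

/-- **Norm of the Laplace main term**: for `c ≠ 0`, `log‖e^{Ψ}·(π/c)^{1/2}‖ = Re Ψ + ½(log π − log‖c‖)` (principal branch;
`‖z^{1/2}‖ = ‖z‖^{1/2}`). -/
theorem log_norm_cexp_mul_cpow_half (Ψ c : ℂ) (hc : c ≠ 0) :
    Real.log ‖Complex.exp Ψ * ((Real.pi : ℂ) / c) ^ (1 / 2 : ℂ)‖ = Ψ.re + 1 / 2 * (Real.log Real.pi - Real.log ‖c‖) := by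
  have hπ : (Real.pi : ℂ) / c ≠ 0 := div_ne_zero (by exact_mod_cast Real.pi_ne_zero) hc
  have hnorm : ‖((Real.pi : ℂ) / c) ^ (1 / 2 : ℂ)‖ = (Real.pi / ‖c‖) ^ (1 / 2 : ℝ) := by
    rw [norm_cpow_of_ne_zero hπ]
    simp [abs_of_pos Real.pi_pos]
  have hpos : 0 < Real.pi / ‖c‖ := div_pos Real.pi_pos (norm_pos_iff.mpr hc)
  rw [norm_mul, Complex.norm_exp, hnorm, Real.log_mul (Real.exp_pos _).ne' (Real.rpow_pos_of_pos hpos _).ne',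
    Real.log_exp, Real.log_rpow hpos, Real.log_div Real.pi_pos.ne' (norm_pos_iff.mpr hc).ne']
  try ring

/-- **Assembly**: if `‖J − e^{Ψ}(π/c)^{1/2}‖ ≤ θ·‖e^{Ψ}(π/c)^{1/2}‖` with `0 ≤ θ ≤ 1/2` and `c ≠ 0`, then `J ≠ 0` and
`|log‖J‖ − (Re Ψ + ½(log π − log‖c‖))| ≤ 2θ`. -/
theorem laplace_log_of_rel_approx {J Ψ c : ℂ} {θ : ℝ} (hc : c ≠ 0) (hθ0 : 0 ≤ θ) (hθ : θ ≤ 1 / 2)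
    (h : ‖J - Complex.exp Ψ * ((Real.pi : ℂ) / c) ^ (1 / 2 : ℂ)‖ ≤ θ * ‖Complex.exp Ψ * ((Real.pi : ℂ) / c) ^ (1 / 2 : ℂ)‖) :
    J ≠ 0 ∧ |Real.log ‖J‖ - (Ψ.re + 1 / 2 * (Real.log Real.pi - Real.log ‖c‖))| ≤ 2 * θ := by
  have hm : Complex.exp Ψ * ((Real.pi : ℂ) / c) ^ (1 / 2 : ℂ) ≠ 0 := by
    refine mul_ne_zero (Complex.exp_ne_zero _) ?_
    rw [Ne, cpow_eq_zero_iff, not_and_or]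
    left
    exact div_ne_zero (by exact_mod_cast Real.pi_ne_zero) hc
  have hθ1 : θ < 1 := by linarith
  refine ⟨ne_zero_of_norm_sub_le_mul hθ1 hm h, ?_⟩
  rw [← log_norm_cexp_mul_cpow_half Ψ c hc]
  exact (abs_log_norm_sub_log_norm_le hθ0 hθ1 hm h).trans (neg_log_one_sub_le_two_mul hθ0 hθ)

end Summit.RiemannHypothesis.RiemannHypothesis.Theorems.JensenPolynomials.WindowEGF

end
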